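import Mathlib
import Summits.Ventures.PercRepro2.OneTypedEdge

/-!
# The marks `o` and `a₃` behind an unmarked cut vertex, I: the kernel on the states (blind cell
PercRepro2, p3 g3, 2026-08-25; `proofs/P3-BRIDGE.md` §11.9 (c))

When an unmarked cut vertex `c` separates `VH ∋ a₁, a₂, b` from `VL ∋ o, a₃`, a copy of the support
has the state `gluedOB r go g3` with `r : R5` the five root-side bits `(a₂ ↔ a₁, a₁ ↔ c, a₂ ↔ c,
a₁ ↔ b, a₂ ↔ b)` and `go, g3` the far bits `c ↔ o`, `c ↔ a₃`.  The kernel is LINEAR in the `o`-bits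
(`KB_gluedOB_lin`: one `o`-factor per term, a ring identity) and, for a fixed `o`-copy, sorted by the
exact `a₃`-pattern (`KB_gluedOB_pat`).  On VALID root bits (`Valid5'`) the six-fold symmetrised
pattern kernels `symOB` satisfy the four ORBIT identities `orbit_a` … `orbit_d` (`decide` over the
`13³` valid triples): the far `a₃`-pattern matters only through whether it contains the `o`-copy —
the root-side content of the two-gadget decomposition.  Own work; standard axioms.
-/

namespace Summit.Ventures.PercRepro2

namespace CovForm

namespace RootBridge

open OneTyped

/-- The five root-side bits `(a₂ ↔ a₁, a₁ ↔ c, a₂ ↔ c, a₁ ↔ b, a₂ ↔ b)`. -/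
abbrev R5 := Bool × Bool × Bool × Bool × Bool

namespace R5
/-- `a₂ ↔ a₁`. -/
def q (r : R5) : Bool := r.1
/-- `a₁ ↔ c`. -/
def a1 (r : R5) : Bool := r.2.1
/-- `a₂ ↔ c`. -/
def a2 (r : R5) : Bool := r.2.2.1
/-- `a₁ ↔ b`. -/
def lb (r : R5) : Bool := r.2.2.2.1
/-- `a₂ ↔ b`. -/
def hb (r : R5) : Bool := r.2.2.2.2
end R5

/-- The state of a copy when `o, a₃` sit beyond `c` and `a₁, a₂, b` on the other side. -/
def gluedOB (r : R5) (go g3 : Bool) : St :=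
  (r.q, r.a1 && go, r.a2 && go, r.lb, r.hb, r.a1 && g3, r.a2 && g3)

/-- A far bit as an integer. -/
def indOB (g : Bool) : ℤ := if g then 1 else 0

/-- `indOB true = 1`. -/
@[simp] lemma indOB_true : indOB true = 1 := rfl
/-- `indOB false = 0`. -/
@[simp] lemma indOB_false : indOB false = 0 := rfl

/-- The kernel on glued states with prescribed `o`-bits and `a₃`-bits. -/
def patOB (ox oy ow sx sy sw : Bool) (rx ry rw : R5) : ℤ :=
  KB (gluedOB rx ox sx) (gluedOB ry oy sy) (gluedOB rw ow sw)

/-- `σ` of a gated pair of bits. -/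
lemma sigB_and (a b g : Bool) : sigB (a && g) (b && g) = sigB a b * indOB g := by
  cases a <;> cases b <;> cases g <;> simp [sigB, indOB]

/-- `u` of a gated pair of bits. -/
lemma uB_and (a b g : Bool) : uB (a && g) (b && g) = uB a b * indOB g := by
  cases a <;> cases b <;> cases g <;> simp [uB, indOB]

/-- **The kernel is linear in the three `o`-bits** (one `o`-factor per term). -/
theorem KB_gluedOB_lin (ox oy ow sx sy sw : Bool) (rx ry rw : R5) :
    patOB ox oy ow sx sy sw rx ry rw =
      patOB true false false sx sy sw rx ry rw * indOB ox +
        patOB false true false sx sy sw rx ry rw * indOB oy +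
        patOB false false true sx sy sw rx ry rw * indOB ow := by
  unfold patOB KB
  simp only [gluedOB, qB, pdB, St.q', St.Lo, St.Ho, St.Lb, St.Hb, St.L3, St.H3, sigB_and, uB_and,
    indOB_true, indOB_false, mul_one, mul_zero]
  ring

/-- The exact `a₃`-pattern indicator. -/
def exactOB (sx sy sw gx gy gw : Bool) : ℤ :=
  (if gx = sx then 1 else 0) * (if gy = sy then 1 else 0) * (if gw = sw then 1 else 0)

/-- **For fixed `o`-bits the kernel is sorted by the exact `a₃`-pattern**. -/
theorem KB_gluedOB_pat (ox oy ow gx gy gw : Bool) (rx ry rw : R5) :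
    patOB ox oy ow gx gy gw rx ry rw =
      patOB ox oy ow false false false rx ry rw * exactOB false false false gx gy gw +
      patOB ox oy ow true false false rx ry rw * exactOB true false false gx gy gw +
      patOB ox oy ow false true false rx ry rw * exactOB false true false gx gy gw +
      patOB ox oy ow false false true rx ry rw * exactOB false false true gx gy gw +
      patOB ox oy ow true true false rx ry rw * exactOB true true false gx gy gw +
      patOB ox oy ow true false true rx ry rw * exactOB true false true gx gy gw +
      patOB ox oy ow false true true rx ry rw * exactOB false true true gx gy gw +
      patOB ox oy ow true true true rx ry rw * exactOB true true true gx gy gw := by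
  cases gx <;> cases gy <;> cases gw <;> simp [exactOB]

/-- **Validity** of root-side bits: transitivity on the triangles `{a₁, a₂, c}` and `{a₁, a₂, b}`. -/
def Valid5' (r : R5) : Bool :=
  (!(r.a1 && r.a2) || r.q) && (!(r.a1 && r.q) || r.a2) && (!(r.a2 && r.q) || r.a1) &&
    (!(r.lb && r.hb) || r.q) && (!(r.lb && r.q) || r.hb) && (!(r.hb && r.q) || r.lb)

/-- The six-fold symmetrisation of a pattern kernel over the root copies. -/
def symOB (ox oy ow sx sy sw : Bool) (rx ry rw : R5) : ℤ :=
  patOB ox oy ow sx sy sw rx ry rw + patOB ox oy ow sx sy sw rx rw ry +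
    patOB ox oy ow sx sy sw ry rx rw + patOB ox oy ow sx sy sw ry rw rx +
    patOB ox oy ow sx sy sw rw rx ry + patOB ox oy ow sx sy sw rw ry rx

/-- The orbit `O₀` (`o` alone, no `a₃`): the sum of the three symmetrised pattern kernels. -/
def orb0 (rx ry rw : R5) : ℤ :=
  symOB true false false false false false rx ry rw + symOB false true false false false false rx ry rw +
    symOB false false true false false false rx ry rw

/-- The orbit `O₁` (`a₃` in one copy other than the `o`-copy). -/
def orb1 (rx ry rw : R5) : ℤ :=
  symOB true false false false true false rx ry rw + symOB true false false false false true rx ry rw +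
    symOB false true false true false false rx ry rw + symOB false true false false false true rx ry rw +
    symOB false false true true false false rx ry rw + symOB false false true false true false rx ry rw

/-- The orbit `O₂` (`a₃` in both other copies). -/
def orb2 (rx ry rw : R5) : ℤ :=
  symOB true false false false true true rx ry rw + symOB false true false true false true rx ry rw +
    symOB false false true true true false rx ry rw

/-- The orbit `O₁′` (`a₃` in the `o`-copy only). -/
def orb1' (rx ry rw : R5) : ℤ :=
  symOB true false false true false false rx ry rw + symOB false true false false true false rx ry rw +
    symOB false false true false false true rx ry rw

/-- The orbit `O₂′` (`a₃` in the `o`-copy and one other). -/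
def orb2' (rx ry rw : R5) : ℤ :=
  symOB true false false true true false rx ry rw + symOB true false false true false true rx ry rw +
    symOB false true false true true false rx ry rw + symOB false true false false true true rx ry rw +
    symOB false false true true false true rx ry rw + symOB false false true false true true rx ry rw

/-- The orbit `O₃′` (`a₃` everywhere). -/
def orb3' (rx ry rw : R5) : ℤ :=
  symOB true false false true true true rx ry rw + symOB false true false true true true rx ry rw +
    symOB false false true true true true rx ry rw

/-- **Orbit identity (a)**: `O₁ = 2·O₀` on valid triples. -/
theorem orbit_a (rx ry rw : R5) (hx : Valid5' rx = true) (hy : Valid5' ry = true)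
    (hw : Valid5' rw = true) : orb1 rx ry rw = 2 * orb0 rx ry rw := by
  revert rx ry rw
  decide +kernel

/-- **Orbit identity (b)**: `O₂ = O₀` on valid triples. -/
theorem orbit_b (rx ry rw : R5) (hx : Valid5' rx = true) (hy : Valid5' ry = true)
    (hw : Valid5' rw = true) : orb2 rx ry rw = orb0 rx ry rw := by
  revert rx ry rw
  decide +kernel

/-- **Orbit identity (c)**: `O₂′ = 2·O₁′` on valid triples. -/
theorem orbit_c (rx ry rw : R5) (hx : Valid5' rx = true) (hy : Valid5' ry = true)
    (hw : Valid5' rw = true) : orb2' rx ry rw = 2 * orb1' rx ry rw := by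
  revert rx ry rw
  decide +kernel

/-- **Orbit identity (d)**: `O₃′ = O₁′` on valid triples. -/
theorem orbit_d (rx ry rw : R5) (hx : Valid5' rx = true) (hy : Valid5' ry = true)
    (hw : Valid5' rw = true) : orb3' rx ry rw = orb1' rx ry rw := by
  revert rx ry rw
  decide +kernel

end RootBridge

end CovForm

end Summit.Ventures.PercRepro2
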